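import Summits.BirchSwinnertonDyer.BirchSwinnertonDyer.Theorems.RamifiedHeegnerPairLeafRankOneUpperAtThreeShimuraInertComposition
import HarnessLib

/-!
# Route `RamifiedHeegnerPair`, crux U₁ `LeafRankOneUpperAtThree` (stmt-BirchSwinnertonDyer-26022), line `splitkolyvagin` —
# the INERT-CARRIER (Shimura-curve) road, part 6: the QUOTABLE two-carrier form

HONEST FRAMING. Theorems only; helper file (`--supports stmt-BirchSwinnertonDyer-26022 --as helper`); nothing is booked, no item is
closed, BSD is not proved for any curve; CONDITIONAL on every displayed input. Lead prover bsd-line-rhp-p2 g10, 2026-08-28.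

Every rank-one Gss2 class of the census (`N < 5·10⁵`) whose Tamagawa-`3` carriers are all split multiplicative has EXACTLY TWO of them; the
road's hypotheses then read, without any auxiliary set: «`q₁ ≠ q₂` split multiplicative with `3 ∣ ord_{q_i} Δ_min`, `q₂` odd with
`q₂ ≢ 1 (mod 3)`, every other split-multiplicative prime has `3 ∤ ord Δ_min`, and `3 ∣ c_q ⇒ q` split multiplicative». This file records that
form (`S = {q₁, q₂}`, (DEG) by Papikian–Rabinoff at `q₂`):

* `leafRankOneUpper_three_of_twoCarriers_of_lowerRankZero` — U₁ at a leaf curve carrying a datum with `3 ∤ c`, from the five named facts +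
  the odd split-supply + L₀;
* `leafRankOneUpper_three_of_twoCarriers_of_twistUnit` — the same at ONE Jetchev–Skinner–Wan field with a twist-unit certificate (TU|inert).

References: [cite: JetchevSkinnerWan2017, §7.4.2 (p. 31), Thm. 4.4.1 (p. 19)] [cite: PastenShimura2024, Prop. 6.13, Lemma 6.18 (pp. 23–24)]
[cite: PapikianRabinoff2016, Cor. 3.5] [cite: FriedbergHoffstein1995, Thm. B] [cite: Miller2011LMS, Def. 1.1].
-/

-- D-0017: single-problem summit, so `Summit.BirchSwinnertonDyer.BirchSwinnertonDyer.…` repeats a namespace BY DESIGN.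
set_option linter.dupNamespace false
set_option autoImplicit false

noncomputable section

open scoped Classical NumberField

open WeierstrassCurve NumberField IsDedekindDomain Literature Literature.NumberTheory.EllipticCurves
  Rat.HeightOneSpectrum
  Literature.NumberTheory.EllipticCurves.ModularForms
  Literature.NumberTheory.EllipticCurves.Rank1Residual
  Literature.NumberTheory.EllipticCurves.Rank1Residual.Typed
  Literature.NumberTheory.QuadraticFields.Quadratic
  Literature.NumberTheory.Automorphic
  Summit.BirchSwinnertonDyer.Rank1Residual
  Summit.BirchSwinnertonDyer.Rank1Residual.Additive
  Summit.BirchSwinnertonDyer.Rank1Residual.X11b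
  Summit.BirchSwinnertonDyer.Rank1Residual.X11b.Three
  Summit.BirchSwinnertonDyer.BirchSwinnertonDyer.Theses.RamifiedHeegnerPair
  Summit.BirchSwinnertonDyer.BirchSwinnertonDyer.Theorems

namespace Summit.BirchSwinnertonDyer.BirchSwinnertonDyer.Theorems.LeafShimuraInert

/-! ## §8 Two split-multiplicative carriers, one of them odd and `≢ 1 (mod 3)` -/

section TwoCarriers

variable (W : WeierstrassCurve ℚ) [W.IsElliptic] [W.IsGloballyMinimal]

omit [W.IsElliptic] in
/-- The inert set `{q₁, q₂}` of two distinct multiplicative primes: even, multiplicative, and — when every other split-multiplicative prime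
is `3`-adically harmless — containing every split-multiplicative carrier; (DEG) in the Papikian–Rabinoff form at `q₂`. Bookkeeping.
[cite: PastenShimura2024, Lemma 6.18 (p. 24)] -/
theorem inertPair_data {q₁ q₂ : ℕ} [Fact q₁.Prime] [Fact q₂.Prime] (hne : q₁ ≠ q₂)
    (h₁ : W.HasSplitMultiplicativeReductionAtPrime q₁) (h₂ : W.HasSplitMultiplicativeReductionAtPrime q₂)
    (hothers : ∀ (ℓ : ℕ) [Fact ℓ.Prime], ℓ ≠ q₁ → ℓ ≠ q₂ → W.HasSplitMultiplicativeReductionAtPrime ℓ →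
      ¬ 3 ∣ padicValInt ℓ W.minimalDiscriminantInt)
    (hq₂2 : q₂ ≠ 2) (hq₂1 : q₂ % 3 ≠ 1) :
    Even ({q₁, q₂} : Finset ℕ).card ∧
    (∀ ℓ ∈ ({q₁, q₂} : Finset ℕ), ∃ _ : Fact ℓ.Prime, W.HasMultiplicativeReductionAtPrime ℓ) ∧
    (∀ (ℓ : ℕ) [Fact ℓ.Prime], ℓ ∉ ({q₁, q₂} : Finset ℕ) → W.HasSplitMultiplicativeReductionAtPrime ℓ →
      ¬ 3 ∣ padicValInt ℓ W.minimalDiscriminantInt) ∧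
    ((∃ ℓ₀ ∈ ({q₁, q₂} : Finset ℕ), ¬ 3 ∣ padicValInt ℓ₀ W.minimalDiscriminantInt) ∨
      (∃ ℓ₀ t : ℕ, ∃ _ : Fact ℓ₀.Prime, ∃ _ : Fact t.Prime,
        W.HasMultiplicativeReductionAtPrime ℓ₀ ∧ W.HasMultiplicativeReductionAtPrime t ∧
        ℓ₀ ∉ ({q₁, q₂} : Finset ℕ) ∧ t ∉ ({q₁, q₂} : Finset ℕ) ∧ t ≠ ℓ₀ ∧
        ¬ 3 ∣ padicValInt ℓ₀ W.minimalDiscriminantInt) ∨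
      (∃ r₁ r₂ : ℕ, ({q₁, q₂} : Finset ℕ) = {r₁, r₂} ∧ r₁ ≠ r₂ ∧ r₂ ≠ 2 ∧ r₂ % 3 ≠ 1)) := by
  refine ⟨?_, ?_, ?_, Or.inr (Or.inr ⟨q₁, q₂, rfl, hne, hq₂2, hq₂1⟩)⟩
  · rw [Finset.card_insert_of_notMem (by simpa using hne), Finset.card_singleton]
    decide
  · intro ℓ hℓ
    rcases Finset.mem_insert.mp hℓ with rfl | hℓ
    · exact ⟨inferInstance, h₁.hasMultiplicativeReductionAtPrime⟩
    · rw [Finset.mem_singleton] at hℓ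
      subst hℓ
      exact ⟨inferInstance, h₂.hasMultiplicativeReductionAtPrime⟩
  · intro ℓ _ hℓ hs
    have hℓ₁ : ℓ ≠ q₁ := fun h ↦ hℓ (by simp [h])
    have hℓ₂ : ℓ ≠ q₂ := fun h ↦ hℓ (by simp [h])
    exact hothers ℓ hℓ₁ hℓ₂ hs

/-- **U₁ AT A LEAF CURVE WITH TWO SPLIT-MULTIPLICATIVE CARRIERS, ONE ODD AND `≢ 1 (mod 3)`, from published facts and L₀ — no Σ.** For
`W/ℚ` globally minimal, non-CM, additive of cell `(G) ∧ ss` at `3`, `r_an = 1`, carrying a datum with `3 ∤ c`; two distinct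
split-multiplicative primes `q₁, q₂` with `q₂` odd, `q₂ ≢ 1 (mod 3)`; every OTHER split-multiplicative prime with `3 ∤ ord Δ_min`; and
SHAPE «`3 ∣ c_q(W) ⇒ q` split multiplicative» (no additive Tamagawa-`3` carrier): `Typed.MissingUpperBoundAt W 3` from the named facts
{GZK, modularity, Jacquet–Langlands, Pasten 2024 §6 component orders, CST14 Thm. 1.5 + JSW17 Thm. 4.4.1, Friedberg–Hoffstein inert-split}
and the route member L₀ `Gss2LowerAtThreeRankZero`. (`q₁, q₂` need not be carriers: if `3 ∤ ord_{q_i}Δ` the bound only improves.)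
Part 4's `…_of_lowerRankZero_of_splitSupply` at `S = {q₁, q₂}`. CONDITIONAL; nothing booked.
[cite: JetchevSkinnerWan2017, §7.4.2 (p. 31), Thm. 4.4.1 (p. 19)] [cite: PastenShimura2024, Prop. 6.13, Lemma 6.18 (pp. 23–24)]
[cite: PapikianRabinoff2016, Cor. 3.5] [cite: FriedbergHoffstein1995, Thm. B] [cite: Miller2011LMS, Def. 1.1] -/
theorem leafRankOneUpper_three_of_twoCarriers_of_lowerRankZero
    -- published inputs (named facts of the tree)
    (hGZK : rank_eq_analyticRank_of_analyticRank_le_one) (hmod : hasEntireLFunction_rat)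
    (hnf : exists_isNewformOf) (hJL : nonempty_shimuraParametrizationData)
    (hCO : PastenShimura2024_componentOrders)
    (hHK : shimuraCurve_heegnerPoint_grossZagier_kolyvagin)
    (hFH2 : friedbergHoffstein_exists_twist_ne_zero_inertAt_splitAt)
    -- the route member L₀ BY NAME
    (hL0 : Summit.BirchSwinnertonDyer.BirchSwinnertonDyer.Theses.RamifiedHeegnerPair.Gss2LowerAtThreeRankZero)
    -- the leaf curve, with a datum whose constant is a `3`-unit
    (hCM : ¬ W.HasCM) (hadd : Addv W 3) (hsub : SubGss W 3) (hr : W.analyticRank = 1)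
    {N : ℕ} [NeZero N] (hN : W.conductorNorm ℤ = N)
    (Dt : ModularParametrizationData W N) (hc : ¬ (3 : ℤ) ∣ Dt.c)
    -- the two carriers and the shape
    {q₁ q₂ : ℕ} [Fact q₁.Prime] [Fact q₂.Prime] (hne : q₁ ≠ q₂)
    (h₁ : W.HasSplitMultiplicativeReductionAtPrime q₁) (h₂ : W.HasSplitMultiplicativeReductionAtPrime q₂)
    (hothers : ∀ (ℓ : ℕ) [Fact ℓ.Prime], ℓ ≠ q₁ → ℓ ≠ q₂ → W.HasSplitMultiplicativeReductionAtPrime ℓ →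
      ¬ 3 ∣ padicValInt ℓ W.minimalDiscriminantInt)
    (hq₂2 : q₂ ≠ 2) (hq₂1 : q₂ % 3 ≠ 1)
    (hshape : ∀ (q : ℕ) [Fact q.Prime], 3 ∣ (W.baseChange ℚ_[q]).localTamagawaNumber ℤ_[q] →
      W.HasSplitMultiplicativeReductionAtPrime q) :
    Typed.MissingUpperBoundAt W 3 := by
  obtain ⟨hSeven, hSmult, hFC, hDEG⟩ := inertPair_data W hne h₁ h₂ hothers hq₂2 hq₂1
  exact leafRankOneUpper_three_of_shimuraInert_of_lowerRankZero_of_splitSupply hGZK hmod hnf hJL hCO hHK hFH2 hL0 W hCM hadd hsub hr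
    hN Dt hc {q₁, q₂} hSeven hSmult hFC hshape hDEG

/-- **The same at ONE Jetchev–Skinner–Wan field with a TWIST-UNIT certificate (TU|inert), no L-member** — the per-curve instrument on the
two-carrier rows: `K` imaginary quadratic with odd `d_K`, `q₁, q₂` inert and unramified, every other prime of `N_W` split,
`L(W^{(d_K)},1) ≠ 0`, and `ord₃ #Ш_an ≤ 0` for the globally minimal models of the twist. Part 5's
`leafRankOneUpper_three_of_shimuraInertDatum_of_twistUnit` at `S = {q₁, q₂}`. CONDITIONAL on the five named facts; an instance, never
progress on the leaf. [cite: JetchevSkinnerWan2017, §7.4.2 (p. 31), Thm. 4.4.1 (p. 19)] [cite: PastenShimura2024, Prop. 6.13, Lemma 6.18 (pp. 23–24)]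
[cite: Miller2011LMS, Def. 1.1] -/
theorem leafRankOneUpper_three_of_twoCarriers_of_twistUnit
    -- published inputs (named facts of the tree)
    (hGZK : rank_eq_analyticRank_of_analyticRank_le_one) (hmod : hasEntireLFunction_rat)
    (hnf : exists_isNewformOf) (hJL : nonempty_shimuraParametrizationData)
    (hCO : PastenShimura2024_componentOrders)
    (hHK : shimuraCurve_heegnerPoint_grossZagier_kolyvagin)
    -- the leaf curve, with a datum whose constant is a `3`-unit
    (hadd : Addv W 3) (hsub : SubGss W 3) (hr : W.analyticRank = 1)
    {N : ℕ} [NeZero N] (hN : W.conductorNorm ℤ = N)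
    (Dt : ModularParametrizationData W N) (hc : ¬ (3 : ℤ) ∣ Dt.c)
    -- the two carriers and the shape
    {q₁ q₂ : ℕ} [Fact q₁.Prime] [Fact q₂.Prime] (hne : q₁ ≠ q₂)
    (h₁ : W.HasSplitMultiplicativeReductionAtPrime q₁) (h₂ : W.HasSplitMultiplicativeReductionAtPrime q₂)
    (hothers : ∀ (ℓ : ℕ) [Fact ℓ.Prime], ℓ ≠ q₁ → ℓ ≠ q₂ → W.HasSplitMultiplicativeReductionAtPrime ℓ →
      ¬ 3 ∣ padicValInt ℓ W.minimalDiscriminantInt)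
    (hq₂2 : q₂ ≠ 2) (hq₂1 : q₂ % 3 ≠ 1)
    (hshape : ∀ (q : ℕ) [Fact q.Prime], 3 ∣ (W.baseChange ℚ_[q]).localTamagawaNumber ℤ_[q] →
      W.HasSplitMultiplicativeReductionAtPrime q)
    -- ONE Jetchev–Skinner–Wan field datum with a twist-unit certificate
    (K : Type) [Field K] [NumberField K] (hK : IsImaginaryQuadratic K) (hodd : Odd (NumberField.discr K))
    (hin₁ : ((Ideal.span {(q₁ : ℤ)}).primesOver (𝓞 K)).ncard = 1 ∧ ¬ (q₁ : ℤ) ∣ NumberField.discr K)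
    (hin₂ : ((Ideal.span {(q₂ : ℤ)}).primesOver (𝓞 K)).ncard = 1 ∧ ¬ (q₂ : ℤ) ∣ NumberField.discr K)
    (hsplitN : ∀ ℓ : ℕ, ℓ.Prime → ℓ ∣ W.conductorNorm ℤ → ℓ ≠ q₁ → ℓ ≠ q₂ →
      ((Ideal.span {(ℓ : ℤ)}).primesOver (𝓞 K)).ncard = 2)
    (hLt : (W.quadraticTwist (NumberField.discr K : ℚ)).entireLFunction 1 ≠ 0)
    (hTU : ∀ (Wd : WeierstrassCurve ℚ) [Wd.IsElliptic] [Wd.IsGloballyMinimal] (Cd : VariableChange ℚ),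
      Cd • W.quadraticTwist (NumberField.discr K : ℚ) = Wd → ∃ qd : ℚ, shaAn Wd = (qd : ℂ) ∧ padicValRat 3 qd ≤ 0) :
    Typed.MissingUpperBoundAt W 3 := by
  obtain ⟨hSeven, hSmult, hFC, hDEG⟩ := inertPair_data W hne h₁ h₂ hothers hq₂2 hq₂1
  refine leafRankOneUpper_three_of_shimuraInertDatum_of_twistUnit hGZK hmod hnf hJL hCO hHK W hadd hsub hr hN Dt hc {q₁, q₂}
    hSeven hSmult hFC hshape hDEG K hK hodd ?_ ?_ hLt hTU
  · intro ℓ hℓ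
    rcases Finset.mem_insert.mp hℓ with rfl | hℓ
    · exact hin₁
    · rw [Finset.mem_singleton] at hℓ
      subst hℓ
      exact hin₂
  · intro ℓ hℓ hℓN hℓS
    exact hsplitN ℓ hℓ hℓN (fun h ↦ hℓS (by simp [h])) (fun h ↦ hℓS (by simp [h]))

end TwoCarriers

end Summit.BirchSwinnertonDyer.BirchSwinnertonDyer.Theorems.LeafShimuraInert

end
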